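import Summits.ValiantsHypothesis.ValiantsHypothesis.Theorems.KPlusLogSqLawTropicalBWalkDesignWeights
import Summits.ValiantsHypothesis.ValiantsHypothesis.Theorems.KPlusLogSqLawTropicalBSplitGlue

/-!
# Route `KPlusLogSqLaw`, crux `TropicalB` — walk designs, II: the STRUCTURE THEOREM and dominance of a cheapest walk

HONEST FRAMING.  Helper file (negative-side calibration) toward the registered stubs `stub_tropThin` / `stub_tropFat` of
`Cruxes/TropicalB/Lines/birth.lean` (crux `TropicalB`, ledger item `stmt-ValiantsHypothesis-19771`, route `KPlusLogSqLaw`,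
DRAFT; cell `pub-symmetroid`, seat `val-sym-trop-p1`, 2026-08-26).  Nothing here proves any part of a stub; nothing asserts
`TropicalB`, `KPlusLogSqLaw`, `MatrixDescartes` or anything about `VP ≠ VNP`.

THE STRUCTURE THEOREM of the walk design (`…TropicalBWalkDesignDefs`, `T ≥ 1`): a PRESENT Leibniz term is either the identity
term (every column on its diagonal entry, class `l₀`) or the walk term of a walk `y` from `v₀` (`present_cases`).  Proof
(`structureP`): a moved column other than `(0, v₀)` is sent one layer down along a present edge, a moved column of layer `0`
must be `(0, v₀)` (sent to the last layer by a back entry); so the orbit of any moved column descends to `(0, v₀)`, the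
iterates `π^k (0, v₀)` run through the layers `T, T−1, …, 1, 0` and return to `(0, v₀)`, every moved column lies on this
cycle (injectivity of `π^ℓ`), and the cycle is the walk permutation of the vertex sequence it visits.  Consequence
(`isDominant_walkTerm`): if `y` is the UNIQUE cheapest walk at the integer slope `θ` with margin `≥ 1`
(`walkCostFin θ y + 1 ≤ walkCostFin θ y'` for every other walk) and the bonus `Ω` beats the identity term
(`walkCostFin θ y + T·θ·d l₀ < Ω`), then the walk term of `y` is the unique optimum (`IsDominant`) of the walk design at `θ`;
and consecutive walk terms alternate in sign iff the edge-sign products of the walks do (`alternate_walkTerm_iff`).  This is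
the term-level reading of the tree's WalkSign/WalkDet lemmas, and the input the staircase bridge needs.  All [folklore].
-/

set_option linter.dupNamespace false
set_option autoImplicit false

namespace Summit.ValiantsHypothesis.ValiantsHypothesis.Theorems.KPlusLogSqLaw.WalkDesign

open Summit.ValiantsHypothesis.ValiantsHypothesis.Theorems.MatrixDescartes.Negative
open Summit.ValiantsHypothesis.ValiantsHypothesis.Theorems.SymmetroidDescartes.DPR
open scoped BigOperators
open Finset

variable {V : Type*} [DecidableEq V] {T K : ℕ} (lay : Fin T → V → V → Option (WEdge K)) (l₀ : Fin K) (v₀ : V)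

/-! ## 1. Present terms on pairs: local structure -/

section Local

variable {π : Equiv.Perm (Fin (T + 1) × V)} {μ : Fin (T + 1) × V → Fin K}
  (hpres : ∀ i, walkEpsP lay l₀ v₀ (π i) i (μ i) ≠ 0)
include hpres

/-- a fixed column carries the padding class. -/
theorem cls_of_fixed {i : Fin (T + 1) × V} (hi : π i = i) : μ i = l₀ := by
  rcases walkEpsP_cases lay l₀ v₀ (hpres i) with h | h | h
  · exact h.2
  · exact absurd hi h.1
  · exact absurd hi h.1

/-- a moved column other than `(0, v₀)` is sent one layer down along a present edge whose class it carries. -/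
theorem step_of_moved {i : Fin (T + 1) × V} (hi : π i ≠ i) (h0 : i ≠ (0, v₀)) :
    i.1.val = (π i).1.val + 1 ∧ ∃ e, layerEdge lay (π i) i = some e ∧ μ i = e.cls := by
  rcases walkEpsP_cases lay l₀ v₀ (hpres i) with h | h | h
  · exact absurd h.1 hi
  · obtain ⟨e, he, hl⟩ := h.2
    exact ⟨layer_of_layerEdge lay he, e, he, hl⟩
  · exfalso
    apply h0
    exact Prod.ext h.2.2.2.1 h.2.2.2.2.1

/-- a moved column of layer `0` is `(0, v₀)`, sent to the last layer, with the padding class. -/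
theorem moved_layer_zero {i : Fin (T + 1) × V} (hi : π i ≠ i) (h0 : i.1.val = 0) :
    i = (0, v₀) ∧ (π i).1 = Fin.last T ∧ μ i = l₀ := by
  rcases walkEpsP_cases lay l₀ v₀ (hpres i) with h | h | h
  · exact absurd h.1 hi
  · obtain ⟨e, he, _⟩ := h.2
    have := layer_of_layerEdge lay he
    omega
  · exact ⟨Prod.ext h.2.2.2.1 h.2.2.2.2.1, h.2.2.1, h.2.2.2.2.2⟩

omit [DecidableEq V] hpres in
/-- the image of a moved point is moved. -/
theorem moved_apply {i : Fin (T + 1) × V} (hi : π i ≠ i) : π (π i) ≠ π i :=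
  fun h => hi (π.injective h)

omit [DecidableEq V] hpres in
/-- iterates of a moved point are moved. -/
theorem moved_pow {i : Fin (T + 1) × V} (hi : π i ≠ i) (j : ℕ) : π ((π ^ j) i) ≠ (π ^ j) i := by
  induction j with
  | zero => simpa using hi
  | succ j ih => rw [pow_succ', Equiv.Perm.mul_apply]; exact moved_apply ih

/-- **Descent.**  The orbit of a moved column descends one layer per step until layer `0`. -/
theorem layer_pow_of_moved {i : Fin (T + 1) × V} (hi : π i ≠ i) :
    ∀ j, j ≤ i.1.val → ((π ^ j) i).1.val = i.1.val - j := by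
  intro j
  induction j with
  | zero => intro _; simp
  | succ j ih =>
    intro hj
    have h1 := ih (by omega)
    have hmv : π ((π ^ j) i) ≠ (π ^ j) i := moved_pow hi j
    have hne : (π ^ j) i ≠ (0, v₀) := by
      intro h
      have := congrArg (fun p : Fin (T + 1) × V => p.1.val) h
      simp only [Fin.val_zero] at this
      omega
    have h2 := (step_of_moved lay l₀ v₀ hpres hmv hne).1
    rw [pow_succ', Equiv.Perm.mul_apply]
    omega

/-- **Every moved column descends onto `(0, v₀)`** after `layer` steps; in particular `(0, v₀)` is then moved. -/
theorem pow_layer_eq_origin {i : Fin (T + 1) × V} (hi : π i ≠ i) : (π ^ i.1.val) i = (0, v₀) := by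
  have h1 := layer_pow_of_moved lay l₀ v₀ hpres hi i.1.val le_rfl
  have hmv : π ((π ^ i.1.val) i) ≠ (π ^ i.1.val) i := moved_pow hi _
  exact (moved_layer_zero lay l₀ v₀ hpres hmv (by omega)).1

end Local

/-! ## 2. The structure theorem on pairs -/

section Structure

variable {π : Equiv.Perm (Fin (T + 1) × V)} {μ : Fin (T + 1) × V → Fin K}

/-- **Structure theorem (pair form).**  A present term of the walk design (`T ≥ 1`) is the identity with the padding
class everywhere, or the walk permutation and class map of a walk from `v₀`. -/
theorem structureP (hT : 0 < T) (hpres : ∀ i, walkEpsP lay l₀ v₀ (π i) i (μ i) ≠ 0) :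
    (π = 1 ∧ ∀ i, μ i = l₀) ∨
    ∃ y : Fin (T + 1) → V, IsLayWalk lay v₀ y ∧ π = walkPerm y ∧ μ = walkClsP lay l₀ y := by
  by_cases h0 : π (0, v₀) = (0, v₀)
  · -- no column is moved
    left
    have hfix : ∀ i, π i = i := by
      intro i
      by_contra hi
      have h1 := pow_layer_eq_origin lay l₀ v₀ hpres hi
      have h2 := moved_pow hi i.1.val
      rw [h1] at h2
      exact h2 h0
    exact ⟨Equiv.ext hfix, fun i => cls_of_fixed lay l₀ v₀ hpres (hfix i)⟩
  · right
    -- the cycle of `(0, v₀)`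
    set c : ℕ → Fin (T + 1) × V := fun k => (π ^ k) (0, v₀) with hc
    have hc0 : c 0 = (0, v₀) := by simp [hc]
    have hcs : ∀ k, c (k + 1) = π (c k) := by intro k; simp only [hc]; rw [pow_succ', Equiv.Perm.mul_apply]
    have hmoved : ∀ k, π (c k) ≠ c k := fun k => moved_pow h0 k
    -- layers along the cycle
    have hlayer : ∀ k, 1 ≤ k → k ≤ T + 1 → (c k).1.val = T + 1 - k := by
      intro k
      induction k with
      | zero => intro h; exact absurd h (by norm_num)
      | succ k ih =>
        intro _ hk
        rcases Nat.eq_zero_or_pos k with rfl | hkpos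
        · rw [hcs, hc0]
          have := (moved_layer_zero lay l₀ v₀ hpres h0 rfl).2.1
          rw [this]; simp
        · have h1 := ih hkpos (by omega)
          have hne : c k ≠ (0, v₀) := by
            intro h
            have := congrArg (fun p : Fin (T + 1) × V => p.1.val) h
            simp only [Fin.val_zero] at this
            omega
          have h2 := (step_of_moved lay l₀ v₀ hpres (hmoved k) hne).1
          rw [hcs]
          omega
    have hcT1 : c (T + 1) = (0, v₀) :=
      (moved_layer_zero lay l₀ v₀ hpres (hmoved (T + 1)) (by have := hlayer (T + 1) (by omega) le_rfl; omega)).1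
    -- the vertex sequence of the cycle
    set y : Fin (T + 1) → V := fun t => (c (T + 1 - t.val)).2 with hy
    have hcy : ∀ t : Fin (T + 1), c (T + 1 - t.val) = (t, y t) := by
      intro t
      refine Prod.ext (Fin.ext ?_) rfl
      rcases Nat.eq_zero_or_pos t.val with ht | ht
      · rw [ht, Nat.sub_zero, hcT1]; simp
      · have := hlayer (T + 1 - t.val) (by have := t.isLt; omega) (by omega)
        have ht' := t.isLt
        simp only at this ⊢
        omega
    have hy0 : y 0 = v₀ := by
      show (c (T + 1 - (0 : Fin (T + 1)).val)).2 = v₀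
      rw [Fin.val_zero, Nat.sub_zero, hcT1]
    -- the image of the cycle point of layer `s+1` is the cycle point of layer `s`
    have hstep : ∀ s : Fin T, π (s.succ, y s.succ) = (s.castSucc, y s.castSucc) := by
      intro s
      rw [← hcy s.succ, ← hcs, ← hcy s.castSucc]
      congr 1
      simp only [Fin.val_succ, Fin.val_castSucc]
      have := s.isLt
      omega
    have hzero : π (0, y 0) = (Fin.last T, y (Fin.last T)) := by
      rw [hy0, ← hc0, ← hcs, ← hcy (Fin.last T)]
      simp
    -- moved cycle points other than `(0, v₀)`: the layer entries and their classes
    have hedge : ∀ s : Fin T, ∃ e, edgeAt lay y s = some e ∧ μ (s.succ, y s.succ) = e.cls := by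
      intro s
      have hmv : π (s.succ, y s.succ) ≠ (s.succ, y s.succ) := by rw [← hcy s.succ]; exact hmoved _
      have hne : ((s.succ, y s.succ) : Fin (T + 1) × V) ≠ (0, v₀) := by
        intro h; have := congrArg (fun p : Fin (T + 1) × V => p.1.val) h; simp at this
      obtain ⟨_, e, he, hμ⟩ := step_of_moved lay l₀ v₀ hpres hmv hne
      rw [hstep s] at he
      refine ⟨e, ?_, hμ⟩
      unfold edgeAt
      rw [← layerEdge_succ lay s]
      exact he
    have hwalk : IsLayWalk lay v₀ y :=
      ⟨hy0, fun s => by obtain ⟨e, he, _⟩ := hedge s; rw [he]; rfl⟩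
    -- every moved column is a cycle point
    have hcyc : ∀ i, π i ≠ i → i.2 = y i.1 := by
      intro i hi
      have h1 := pow_layer_eq_origin lay l₀ v₀ hpres hi
      have h2 : (π ^ i.1.val) (c (T + 1 - i.1.val)) = (0, v₀) := by
        show (π ^ i.1.val) ((π ^ (T + 1 - i.1.val)) (0, v₀)) = (0, v₀)
        rw [← Equiv.Perm.mul_apply, ← pow_add]
        have : i.1.val + (T + 1 - i.1.val) = T + 1 := by have := i.1.isLt; omega
        rw [this]
        exact hcT1
      have h3 : i = c (T + 1 - i.1.val) := (π ^ i.1.val).injective (h1.trans h2.symm)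
      rw [hcy i.1] at h3
      exact (congrArg Prod.snd h3).trans rfl
    refine ⟨y, hwalk, Equiv.ext fun i => ?_, funext fun i => ?_⟩
    · -- the permutation
      by_cases hi : i.2 = y i.1
      · obtain ⟨t, x⟩ := i
        simp only at hi
        subst hi
        rcases Fin.eq_zero_or_eq_succ t with rfl | ⟨s, rfl⟩
        · rw [hzero, walkPerm_zero]
        · rw [hstep s, walkPerm_succ]
      · have hfix : π i = i := by by_contra h; exact hi (hcyc i h)
        rw [hfix, walkPerm_apply_of_ne y hi]
    · -- the class map
      by_cases hi : i.2 = y i.1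
      · obtain ⟨t, x⟩ := i
        simp only at hi
        subst hi
        rcases Fin.eq_zero_or_eq_succ t with rfl | ⟨s, rfl⟩
        · rw [walkClsP_zero, hy0]
          exact (moved_layer_zero lay l₀ v₀ hpres h0 rfl).2.2
        · obtain ⟨e, he, hμ⟩ := hedge s
          rw [hμ, walkClsP_succ lay l₀ s he]
      · have hfix : π i = i := by by_contra h; exact hi (hcyc i h)
        rw [cls_of_fixed lay l₀ v₀ hpres hfix, walkClsP_of_not lay l₀ (fun h => hi h.1)]

end Structure

/-! ## 3. Present terms and dominance on `Fin m` -/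

section Dominance

variable [Fintype V] {m : ℕ} (ι : Fin (T + 1) × V ≃ Fin m) (d : Fin K → ℕ) (Ω : ℤ) (θ : ℤ)

omit [Fintype V] in
/-- **Structure theorem.**  A present term of the walk design on `Fin m` is the identity term or the walk term of a walk
from `v₀`. -/
theorem present_cases (hT : 0 < T) (q : Equiv.Perm (Fin m) × (Fin m → Fin K))
    (hq : termSign (walkEps ι lay l₀ v₀) q ≠ 0) :
    q = idTerm l₀ ∨ ∃ y, IsLayWalk lay v₀ y ∧ q = walkTerm ι lay l₀ y := by
  have hpres' := (termSign_ne_zero_iff (walkEps ι lay l₀ v₀) q).mp hq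
  -- transport to pairs
  set π : Equiv.Perm (Fin (T + 1) × V) := (ι.trans q.1).trans ι.symm with hπ
  set μ : Fin (T + 1) × V → Fin K := fun i => q.2 (ι i) with hμ
  have hpres : ∀ i, walkEpsP lay l₀ v₀ (π i) i (μ i) ≠ 0 := by
    intro i
    have := hpres' (ι i)
    unfold walkEps at this
    simpa [hπ, hμ] using this
  rcases structureP lay l₀ v₀ hT hpres with ⟨h1, h2⟩ | ⟨y, hy, h1, h2⟩
  · left
    unfold idTerm
    refine Prod.ext (Equiv.ext fun a => ?_) (funext fun a => ?_)
    · have := Equiv.congr_fun h1 (ι.symm a)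
      simp only [hπ, Equiv.trans_apply, Equiv.apply_symm_apply, Equiv.Perm.one_apply] at this
      simpa using congrArg ι this
    · have := h2 (ι.symm a)
      simpa [hμ] using this
  · right
    refine ⟨y, hy, Prod.ext (Equiv.ext fun a => ?_) (funext fun a => ?_)⟩
    · unfold walkTerm
      have := Equiv.congr_fun h1 (ι.symm a)
      simp only [hπ, Equiv.trans_apply, Equiv.apply_symm_apply] at this
      simp only [Equiv.trans_apply]
      rw [← this]
      simp
    · unfold walkTerm
      have := congr_fun h2 (ι.symm a)
      simpa [hμ] using this

/-- **Dominance of the cheapest walk.**  If the walk `y` is the unique cheapest walk from `v₀` at the slope `θ` with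
margin `≥ 1`, and the bonus `Ω` beats the identity term, then the walk term of `y` is the unique optimum of the walk
design at `θ`. -/
theorem isDominant_walkTerm (hT : 0 < T) {y : Fin (T + 1) → V} (hy : IsLayWalk lay v₀ y)
    (hΩ : walkCostFin d lay θ y + (T : ℤ) * (θ * (d l₀ : ℤ)) < Ω)
    (hmin : ∀ y', IsLayWalk lay v₀ y' → y' ≠ y → walkCostFin d lay θ y + 1 ≤ walkCostFin d lay θ y') :
    IsDominant d (walkVal ι lay Ω v₀) (walkEps ι lay l₀ v₀) θ (walkTerm ι lay l₀ y) := by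
  refine ⟨termSign_walkTerm_ne_zero ι lay l₀ v₀ hT hy, fun q hq hqs => ?_⟩
  rcases present_cases lay l₀ v₀ ι hT q hqs with rfl | ⟨y', hy', rfl⟩
  · rw [tropWeight_idTerm, tropWeight_walkTerm ι d lay l₀ Ω v₀ θ hT hy]
    nlinarith
  · have hne : y' ≠ y := fun h => hq (by rw [h])
    have h1 := hmin y' hy' hne
    rw [tropWeight_walkTerm ι d lay l₀ Ω v₀ θ hT hy', tropWeight_walkTerm ι d lay l₀ Ω v₀ θ hT hy]
    linarith

/-- **Alternation of walk terms** = alternation of the edge-sign products (the common factor `(−1)^T` squares away). -/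
theorem alternate_walkTerm_iff (hT : 0 < T) {y y' : Fin (T + 1) → V} (hy : IsLayWalk lay v₀ y)
    (hy' : IsLayWalk lay v₀ y') :
    termSign (walkEps ι lay l₀ v₀) (walkTerm ι lay l₀ y) * termSign (walkEps ι lay l₀ v₀) (walkTerm ι lay l₀ y') < 0 ↔
      walkSgnFin lay y * walkSgnFin lay y' < 0 := by
  rw [termSign_walkTerm ι lay l₀ v₀ hT hy, termSign_walkTerm ι lay l₀ v₀ hT hy']
  have h1 : ((-1 : ℤ) ^ T) * ((-1 : ℤ) ^ T) = 1 := by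
    rw [← mul_pow]; norm_num
  have e : (-1 : ℤ) ^ T * walkSgnFin lay y * ((-1) ^ T * walkSgnFin lay y') =
      ((-1 : ℤ) ^ T * (-1) ^ T) * (walkSgnFin lay y * walkSgnFin lay y') := by ring
  rw [e, h1, one_mul]

end Dominance

end Summit.ValiantsHypothesis.ValiantsHypothesis.Theorems.KPlusLogSqLaw.WalkDesign
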